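import Summits.CriticalPhenomena.SAWScalingLimit.Theorems.SAWLeftRightFKGFKGToTraversalBoundBBBudgetPrep
import Summits.CriticalPhenomena.SAWScalingLimit.Theorems.SAWLeftRightFKGFKGToTraversalBoundBBBasic
import Summits.CriticalPhenomena.SAWScalingLimit.Theorems.SAWLeftRightFKGFKGToTraversalBoundBBCyclic
import Summits.CriticalPhenomena.SAWScalingLimit.Theorems.SAWLeftRightFKGFKGToTraversalBoundBBFourPoint
import Literature.Topology.PlaneTopology.JordanDomainLocalJoin
import Literature.Probability.Percolation.BoxCrossingProofs
import HarnessLib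

/-!
# Boundary budget, unit BB7 (part 2): the assembly of `BoundaryBudget`
(witness unit U6 of line `slit-necklace`)

Crux `SAWLeftRightFKG.FKGToTraversalBound` (stmt-CriticalPhenomena-1878), line `slit-necklace`, lead
prover-line-stmt-CriticalPhenomena-1878-c5-0; wave 6 (the BOUNDARY BUDGET), unit BB7, part 2 of 2: the registered stub
`stub_boundaryBudget : BoundaryBudget` (…`BoundaryBudget.lean`).

Proof.  Fix the Dobrushin domain `D`, the shell `D(y; σ₁, σ₂)` and a Schoenflies homeomorphism `H` of `ℂ` carrying
the unit disc / circle / closed disc onto `D` / `∂D` / `closure D` (`exists_schoenflies`); the BUDGET CURVE is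
`Γ u = H (e^{2πiu})`.  With `w = (σ₂ - σ₁)/4`, `Γ` has fewer than `k₀` separate traversals of `D(y; σ₁ + w, σ₂ - w)`
(`Curve.exists_not_hasTraversals`); we show `q ≤ 401 (k₀ + 1)` for `0 < δ ≤ w`.
1. FEET (`bb_foot`, unit BB1): each of the `2q` end edges has a first frontier point on its unit segment
   site → contact, within `δ` of the site point.
2. THINNING (`bbB_fibre`, `bbB_greedy`, part 1): end edges are pairwise distinct (injective tour period), a common
   foot forces sites within `2δ`, so every foot value is shared by `≤ 100` start edges and `≤ 100` finish edges; a
   window conflicts with `≤ 400` others, and a greedy conflict-free subfamily keeps `q' ≥ q / 401` windows whose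
   `2q'` feet are pairwise distinct (the two feet of ONE window differ because they lie on different sides of the
   thinner shell).
3. CORE (`bbB_core`): read the feet as angles `ψ ∈ [0, 2π)` through `H` (`bbB_angle`); for four ends
   `i < j < k < l` the planar four-point lemma `bb_four_point` (unit BB5) says that `ψ k` separates `ψ j` from `ψ l`
   in the window `(ψ i, ψ i + 2π)` (`bbB_lift`), which is the hypothesis of the cyclic-window combinatorics
   `bb_cyclic_windows` (unit BB6): `k ≥ q' - 2` windows have increasing, pairwise disjoint angular parameter
   windows, i.e. `Γ` has `k` separate traversals of `D(y; σ₁ + δ, σ₂ - δ)` (`bbB_traversals`).  Hence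
   `q' ≤ k + 2 ≤ k₀ + 1`.

All statements folklore; no literature fact is introduced; nothing restates the crux.
-/

noncomputable section

open Filter Topology Set Metric
open Literature.Probability.LatticeModels
open Literature.Probability.RandomPlanarGeometry
open Literature.Topology.PlaneTopology

namespace Summit.CriticalPhenomena.SAWScalingLimit.Theorems.FKGToTraversalBound.SlitNecklace

/-! ### The core: a conflict-free family of windows gives traversals of the budget curve -/

/-- **Core of the boundary budget.**  Let `H` be a Schoenflies homeomorphism for `D` and `Γ u = H (e^{2πiu})` the
budget curve.  Given `q` strictly separated windows `[a m, b m]` of an injective tour period of the discretised piece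
`B` across the shell `D(y; σ₁, σ₂)`, feet `Fa m`, `Fb m` of their end edges (first frontier points on the unit
segments site → contact, within `δ` of the site points) which are PAIRWISE DISTINCT, and `σ₁ + δ < σ₂ - δ`, the curve
`Γ` has `k` separate traversals of `D(y; σ₁ + δ, σ₂ - δ)` for some `k ≥ q - 2`.  (Angles of the feet, the planar
four-point lemma `bb_four_point`, the cyclic-window combinatorics `bb_cyclic_windows`, `bbB_traversals`.) [folklore] -/
theorem bbB_core (D : DobrushinDomain) (δ : ℝ) (B : Finset (Site 2)) (e : Site 2 × ODir) (N : ℕ)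
    (H : ℂ ≃ₜ ℂ) (Γ : Curve ℂ) (y : ℂ) (σ₁ σ₂ : ℝ) (q : ℕ) (a b : ℕ → ℕ) (Fa Fb : ℕ → ℂ)
    (hδ : 0 < δ) (hσδ : σ₁ + δ < σ₂ - δ)
    (hBD : ∀ x ∈ B, meshPoint δ x ∈ D.carrier)
    (hBG : ∀ x ∈ B, ∀ x' ∈ B, (zdGraph 2).Adj x x' → (discreteDomainGraph D.carrier δ).Adj x x')
    (hBconn : ∀ x ∈ B, ∀ x' ∈ B, ∃ w : (zdGraph 2).Walk x x', ∀ z ∈ w.support, z ∈ B)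
    (he : IsBEdge (↑B : Set (Site 2)) e) (hN : 0 < N) (hper : btour (↑B : Set (Site 2)) e N = e)
    (hinj : ∀ j j', j < N → j' < N → btour (↑B : Set (Site 2)) e j = btour (↑B : Set (Site 2)) e j' → j = j')
    (hball : H '' Metric.ball 0 1 = D.carrier) (hsphere : H '' Metric.sphere 0 1 = frontier D.carrier)
    (hclosed : H '' Metric.closedBall 0 1 = closure D.carrier)
    (hΓ : ∀ u : unitInterval, Γ u = H (circleMap 0 1 (2 * Real.pi * (u : ℝ))))
    (hab : ∀ m, m < q → a m < b m ∧ b m < N) (hsep : ∀ m m', m < m' → m' < q → b m < a m')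
    (hside : ∀ m, m < q →
      (dist (meshPoint δ (bsite (btour (↑B : Set (Site 2)) e (a m)))) y ≤ σ₁ ∧
          σ₂ ≤ dist (meshPoint δ (bsite (btour (↑B : Set (Site 2)) e (b m)))) y) ∨
        (σ₂ ≤ dist (meshPoint δ (bsite (btour (↑B : Set (Site 2)) e (a m)))) y ∧
          dist (meshPoint δ (bsite (btour (↑B : Set (Site 2)) e (b m)))) y ≤ σ₁))
    (hFa : ∀ m, m < q → Fa m ∈ frontier D.carrier ∧
      Fa m ∈ segment ℝ (meshPoint δ (bsite (btour (↑B : Set (Site 2)) e (a m))))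
        (meshPoint δ (bcontact (btour (↑B : Set (Site 2)) e (a m)))) ∧
      Fa m ≠ meshPoint δ (bsite (btour (↑B : Set (Site 2)) e (a m))) ∧
      (∀ z ∈ segment ℝ (meshPoint δ (bsite (btour (↑B : Set (Site 2)) e (a m)))) (Fa m), z ≠ Fa m →
        z ∈ D.carrier) ∧
      dist (Fa m) (meshPoint δ (bsite (btour (↑B : Set (Site 2)) e (a m)))) ≤ δ)
    (hFb : ∀ m, m < q → Fb m ∈ frontier D.carrier ∧
      Fb m ∈ segment ℝ (meshPoint δ (bsite (btour (↑B : Set (Site 2)) e (b m))))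
        (meshPoint δ (bcontact (btour (↑B : Set (Site 2)) e (b m)))) ∧
      Fb m ≠ meshPoint δ (bsite (btour (↑B : Set (Site 2)) e (b m))) ∧
      (∀ z ∈ segment ℝ (meshPoint δ (bsite (btour (↑B : Set (Site 2)) e (b m)))) (Fb m), z ≠ Fb m →
        z ∈ D.carrier) ∧
      dist (Fb m) (meshPoint δ (bsite (btour (↑B : Set (Site 2)) e (b m)))) ≤ δ)
    (hFai : ∀ m m', m < q → m' < q → Fa m = Fa m' → m = m')
    (hFbi : ∀ m m', m < q → m' < q → Fb m = Fb m' → m = m')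
    (hFab : ∀ m m', m < q → m' < q → m ≠ m' → Fa m ≠ Fb m') :
    ∃ k, q ≤ k + 2 ∧ Γ.HasTraversals k y (σ₁ + δ) (σ₂ - δ) := by
  -- the `2q` ends indexed by `ℕ`: end `2m` is the start `a m`, end `2m + 1` the finish `b m`
  set pos : ℕ → ℕ := fun j => if j % 2 = 0 then a (j / 2) else b (j / 2) with hpos
  set Fe : ℕ → ℂ := fun j => if j % 2 = 0 then Fa (j / 2) else Fb (j / 2) with hFe
  have hpos0 : ∀ m, pos (2 * m) = a m := fun m => bbB_ite_even m a b
  have hpos1 : ∀ m, pos (2 * m + 1) = b m := fun m => bbB_ite_odd m a b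
  have hFe0 : ∀ m, Fe (2 * m) = Fa m := fun m => bbB_ite_even m Fa Fb
  have hFe1 : ∀ m, Fe (2 * m + 1) = Fb m := fun m => bbB_ite_odd m Fa Fb
  have hmono : ∀ i j, i < j → j < 2 * q → pos i < pos j := bbB_pos_lt q N a b hab hsep
  have hltN : ∀ j, j < 2 * q → pos j < N := bbB_pos_ltN q N a b hab
  have hfoot : ∀ j, j < 2 * q → (Fe j ∈ frontier D.carrier ∧
      Fe j ∈ segment ℝ (meshPoint δ (bsite (btour (↑B : Set (Site 2)) e (pos j))))
        (meshPoint δ (bcontact (btour (↑B : Set (Site 2)) e (pos j)))) ∧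
      Fe j ≠ meshPoint δ (bsite (btour (↑B : Set (Site 2)) e (pos j))) ∧
      ∀ z ∈ segment ℝ (meshPoint δ (bsite (btour (↑B : Set (Site 2)) e (pos j)))) (Fe j), z ≠ Fe j →
        z ∈ D.carrier) ∧
      dist (Fe j) (meshPoint δ (bsite (btour (↑B : Set (Site 2)) e (pos j)))) ≤ δ := by
    intro j hj
    obtain ⟨m, rfl | rfl⟩ := Nat.even_or_odd' j
    · rw [hpos0, hFe0]
      obtain ⟨h1, h2, h3, h4, h5⟩ := hFa m (by omega)
      exact ⟨⟨h1, h2, h3, h4⟩, h5⟩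
    · rw [hpos1, hFe1]
      obtain ⟨h1, h2, h3, h4, h5⟩ := hFb m (by omega)
      exact ⟨⟨h1, h2, h3, h4⟩, h5⟩
  -- the feet of a window lie on the two sides of the thinner shell
  have hnear : ∀ m, m < q → (dist (Fe (2 * m)) y ≤ σ₁ + δ ∧ σ₂ - δ ≤ dist (Fe (2 * m + 1)) y) ∨
      (σ₂ - δ ≤ dist (Fe (2 * m)) y ∧ dist (Fe (2 * m + 1)) y ≤ σ₁ + δ) := by
    intro m hm
    rw [hFe0, hFe1]
    have ha := abs_le.1 ((abs_dist_sub_le (Fa m) (meshPoint δ (bsite (btour (↑B : Set (Site 2)) e (a m)))) y).trans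
      (hFa m hm).2.2.2.2)
    have hb := abs_le.1 ((abs_dist_sub_le (Fb m) (meshPoint δ (bsite (btour (↑B : Set (Site 2)) e (b m)))) y).trans
      (hFb m hm).2.2.2.2)
    rcases hside m hm with ⟨h1, h2⟩ | ⟨h1, h2⟩
    · exact Or.inl ⟨by linarith [ha.2], by linarith [hb.1]⟩
    · exact Or.inr ⟨by linarith [ha.1], by linarith [hb.2]⟩
  -- the `2q` feet are pairwise distinct
  have hx : ∀ m m', m < q → m' < q → Fa m ≠ Fb m' := by
    intro m m' hm hm'
    by_cases hmm : m = m'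
    · subst hmm
      intro h
      have h1 := hnear m hm
      rw [hFe0, hFe1, h] at h1
      rcases h1 with ⟨h1, h2⟩ | ⟨h1, h2⟩ <;> linarith
    · exact hFab m m' hm hm' hmm
  have hFinj : ∀ j j', j < 2 * q → j' < 2 * q → Fe j = Fe j' → j = j' := by
    intro j j' hj hj' h
    obtain ⟨m, rfl | rfl⟩ := Nat.even_or_odd' j <;> obtain ⟨m', rfl | rfl⟩ := Nat.even_or_odd' j'
    · rw [hFe0, hFe0] at h
      have := hFai m m' (by omega) (by omega) h
      omega
    · rw [hFe0, hFe1] at h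
      exact absurd h (hx m m' (by omega) (by omega))
    · rw [hFe1, hFe0] at h
      exact absurd h.symm (hx m' m (by omega) (by omega))
    · rw [hFe1, hFe1] at h
      have := hFbi m m' (by omega) (by omega) h
      omega
  -- angles of the feet
  have hang : ∀ j, ∃ ψ : ℝ, 0 ≤ ψ ∧ ψ < 2 * Real.pi ∧ (j < 2 * q → H (circleMap 0 1 ψ) = Fe j) := by
    intro j
    by_cases hj : j < 2 * q
    · obtain ⟨ψ, h0, h1, h2⟩ := bbB_angle H _ (Fe j) hsphere (hfoot j hj).1.1
      exact ⟨ψ, h0, h1, fun _ => h2⟩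
    · exact ⟨0, le_rfl, Real.two_pi_pos, fun h => absurd h hj⟩
  choose ψ hψ0 hψ1 hψF using hang
  have hψinj : ∀ i j, i < 2 * q → j < 2 * q → ψ i = ψ j → i = j := by
    intro i j hi hj h
    apply hFinj i j hi hj
    rw [← hψF i hi, ← hψF j hj, h]
  -- quadruples: the planar four-point lemma
  have hquad : ∀ i j k l, i < j → j < k → k < l → l < 2 * q →
      ((toIocMod Real.two_pi_pos (ψ i) (ψ j) < toIocMod Real.two_pi_pos (ψ i) (ψ k) ∧
        toIocMod Real.two_pi_pos (ψ i) (ψ k) < toIocMod Real.two_pi_pos (ψ i) (ψ l)) ∨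
      (toIocMod Real.two_pi_pos (ψ i) (ψ l) < toIocMod Real.two_pi_pos (ψ i) (ψ k) ∧
        toIocMod Real.two_pi_pos (ψ i) (ψ k) < toIocMod Real.two_pi_pos (ψ i) (ψ j))) := by
    intro i j k l hij hjk hkl hl
    have hi : i < 2 * q := by omega
    have hj : j < 2 * q := by omega
    have hk : k < 2 * q := by omega
    have hne : ∀ n, n < 2 * q → i ≠ n → ψ i ≠ ψ n := fun n hn hin h => hin (hψinj i n hi hn h)
    obtain ⟨hj1, hj2, hj3⟩ := bbB_lift (ψ i) (ψ j) (hψ0 i) (hψ1 i) (hψ0 j) (hψ1 j) (hne j hj (by omega))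
    obtain ⟨hk1, hk2, hk3⟩ := bbB_lift (ψ i) (ψ k) (hψ0 i) (hψ1 i) (hψ0 k) (hψ1 k) (hne k hk (by omega))
    obtain ⟨hl1, hl2, hl3⟩ := bbB_lift (ψ i) (ψ l) (hψ0 i) (hψ1 i) (hψ0 l) (hψ1 l) (hne l hl (by omega))
    let idx : Fin 4 → ℕ := ![i, j, k, l]
    have hidx : ∀ x, idx x < 2 * q := by
      intro x
      fin_cases x
      exacts [hi, hj, hk, hl]
    have hinj4 : Function.Injective fun x : Fin 4 => Fe (idx x) := by
      intro x x' h
      have h' := hFinj (idx x) (idx x') (hidx x) (hidx x') h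
      fin_cases x <;> fin_cases x' <;> simp [idx] at h' ⊢ <;> omega
    have hcirc4 : ∀ x : Fin 4, H (circleMap 0 1 (![ψ i, toIocMod Real.two_pi_pos (ψ i) (ψ j),
        toIocMod Real.two_pi_pos (ψ i) (ψ k), toIocMod Real.two_pi_pos (ψ i) (ψ l)] x)) =
        (fun x : Fin 4 => Fe (idx x)) x := by
      intro x
      fin_cases x
      · exact hψF i hi
      · simpa [idx, hj3] using hψF j hj
      · simpa [idx, hk3] using hψF k hk
      · simpa [idx, hl3] using hψF l hl
    have h4 := bb_four_point D δ B e N (fun x => pos (idx x)) (fun x => Fe (idx x)) H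
      ![ψ i, toIocMod Real.two_pi_pos (ψ i) (ψ j), toIocMod Real.two_pi_pos (ψ i) (ψ k),
        toIocMod Real.two_pi_pos (ψ i) (ψ l)]
      hδ hBD hBG hBconn he hN hper hinj (hmono i j hij hj) (hmono j k hjk hk) (hmono k l hkl hl)
      ((hltN l hl).trans_le (Nat.le_add_left N (pos i))) (fun x => (hfoot (idx x) (hidx x)).1)
      hball hsphere hclosed hinj4 hcirc4 hj1 hj2 hk1 hk2 hl1 hl2
    simpa using h4
  -- cyclic windows and traversals
  obtain ⟨k, s, t, hqk, hst, hsep', hwin⟩ := bb_cyclic_windows q ψ (fun i _ => ⟨hψ0 i, hψ1 i⟩) hψinj hquad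
  refine ⟨k, hqk, bbB_traversals Γ (fun θ => H (circleMap 0 1 θ)) y (σ₁ + δ) (σ₂ - δ) q k ψ s t hΓ hst hsep'
    hwin ?_⟩
  intro m hm
  show (dist (H (circleMap 0 1 (ψ (2 * m)))) y ≤ σ₁ + δ ∧ σ₂ - δ ≤ dist (H (circleMap 0 1 (ψ (2 * m + 1)))) y) ∨
    (σ₂ - δ ≤ dist (H (circleMap 0 1 (ψ (2 * m)))) y ∧ dist (H (circleMap 0 1 (ψ (2 * m + 1)))) y ≤ σ₁ + δ)
  rw [hψF _ (by omega), hψF _ (by omega)]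
  exact hnear m hm

/-! ### The assembly -/

/-- **Registered stub `stub_boundaryBudget` (U6): the BOUNDARY BUDGET.**  For a Dobrushin domain `D` and a
genuine shell `D(y; σ₁, σ₂)` there is `nB` such that for all small meshes `δ`, along one injective period of the
wall-follower tour of any discretised piece `B` of `D`, every family of strictly separated tour windows across the
shell both of whose end edges face `∂D` has at most `nB` members: feet of the end edges (`bb_foot`), greedy thinning
to pairwise distinct feet (`bbB_fibre`, `bbB_greedy`), and the core `bbB_core` (angles, `bb_four_point`,
`bb_cyclic_windows`, traversals of the budget curve, `Curve.exists_not_hasTraversals`). [folklore] -/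
theorem stub_boundaryBudget : BoundaryBudget := by
  intro D y σ₁ σ₂ hσ₁ hσ
  obtain ⟨H, hball, hsphere, hclosed⟩ := exists_schoenflies D.toJordanDomain
  -- the budget curve: the boundary loop read through the Schoenflies homeomorphism
  have hcont : Continuous fun u : unitInterval => H (circleMap 0 1 (2 * Real.pi * (u : ℝ))) :=
    H.continuous.comp ((continuous_circleMap 0 1).comp (continuous_const.mul continuous_subtype_val))
  obtain ⟨Γ, hΓ⟩ : ∃ Γ : Curve ℂ, ∀ u : unitInterval, Γ u = H (circleMap 0 1 (2 * Real.pi * (u : ℝ))) :=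
    ⟨⟨⟨_, hcont⟩⟩, fun u => rfl⟩
  obtain ⟨w, hw0, hw⟩ : ∃ w : ℝ, 0 < w ∧ 4 * w = σ₂ - σ₁ := ⟨(σ₂ - σ₁) / 4, by linarith, by ring⟩
  obtain ⟨k₀, hk₀⟩ := Γ.exists_not_hasTraversals y (r := σ₁ + w) (R := σ₂ - w) (by linarith)
  refine ⟨401 * (k₀ + 1), ?_⟩
  have hev : ∀ᶠ δ in 𝓝[>] (0 : ℝ), 0 < δ ∧ δ ≤ w := by
    have h1 : ∀ᶠ δ in 𝓝[>] (0 : ℝ), δ ∈ Ioi (0 : ℝ) := self_mem_nhdsWithin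
    have h2 : ∀ᶠ δ in 𝓝[>] (0 : ℝ), δ ∈ Iic w := mem_nhdsWithin_of_mem_nhds (Iic_mem_nhds hw0)
    filter_upwards [h1, h2] with δ h1 h2 using ⟨h1, h2⟩
  filter_upwards [hev] with δ hδw
  obtain ⟨hδ, hδw⟩ := hδw
  intro B e N q a b hBD hBG hBconn _ he hN hper hinj hab hsep hside hface
  -- (1) feet of the `2q` end edges
  have hsite : ∀ n, meshPoint δ (bsite (btour (↑B : Set (Site 2)) e n)) ∈ D.carrier :=
    fun n => hBD _ (btour_isBEdge _ he n).1
  choose Fa hFa using fun m : Fin q => bb_foot D δ _ (hsite (a m)) (hface m).1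
  choose Fb hFb using fun m : Fin q => bb_foot D δ _ (hsite (b m)) (hface m).2
  have hcd : ∀ E : Site 2 × ODir, dist (meshPoint δ (bcontact E)) (meshPoint δ (bsite E)) = |δ| := by
    intro E
    rw [dist_comm]
    exact Literature.Probability.Percolation.dist_meshPoint_of_adj (ODir.adj_add_vec E.1 E.2)
  have habs : |δ| = δ := abs_of_pos hδ
  have hFad : ∀ m, dist (Fa m) (meshPoint δ (bsite (btour (↑B : Set (Site 2)) e (a m)))) ≤ |δ| :=
    fun m => (hFa m).2.2.2.2.trans (hcd _).le
  have hFbd : ∀ m, dist (Fb m) (meshPoint δ (bsite (btour (↑B : Set (Site 2)) e (b m)))) ≤ |δ| :=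
    fun m => (hFb m).2.2.2.2.trans (hcd _).le
  -- (2) the end-edge maps are injective (injective tour period, strictly increasing ends)
  have hainj : Function.Injective a := fun m m' h => by
    by_contra hne
    rcases lt_or_gt_of_ne hne with hlt | hlt
    · exact absurd h (((hab m).1.trans (hsep hlt)).ne)
    · exact absurd h (((hab m').1.trans (hsep hlt)).ne')
  have hbinj : Function.Injective b := fun m m' h => by
    by_contra hne
    rcases lt_or_gt_of_ne hne with hlt | hlt
    · exact absurd h (((hsep hlt).trans (hab m').1).ne)
    · exact absurd h (((hsep hlt).trans (hab m).1).ne')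
  have hEa : Function.Injective fun m => btour (↑B : Set (Site 2)) e (a m) := fun m m' h =>
    hainj (hinj _ _ ((hab m).1.trans (hab m).2) ((hab m').1.trans (hab m').2) h)
  have hEb : Function.Injective fun m => btour (↑B : Set (Site 2)) e (b m) := fun m m' h =>
    hbinj (hinj _ _ (hab m).2 (hab m').2 h)
  -- (3) thinning: a greedy conflict-free subfamily of windows
  have hsymm : ∀ m m' : Fin q, (m ≠ m' ∧ (Fa m = Fa m' ∨ Fa m = Fb m' ∨ Fb m = Fa m' ∨ Fb m = Fb m')) →
      (m' ≠ m ∧ (Fa m' = Fa m ∨ Fa m' = Fb m ∨ Fb m' = Fa m ∨ Fb m' = Fb m)) := by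
    rintro m m' ⟨hne, h | h | h | h⟩
    · exact ⟨hne.symm, Or.inl h.symm⟩
    · exact ⟨hne.symm, Or.inr (Or.inr (Or.inl h.symm))⟩
    · exact ⟨hne.symm, Or.inr (Or.inl h.symm)⟩
    · exact ⟨hne.symm, Or.inr (Or.inr (Or.inr h.symm))⟩
  have hdeg : ∀ m : Fin q, ∃ T : Finset (Fin q), T.card ≤ 400 ∧
      ∀ m', (m ≠ m' ∧ (Fa m = Fa m' ∨ Fa m = Fb m' ∨ Fb m = Fa m' ∨ Fb m = Fb m')) → m' ∈ T := by
    intro m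
    classical
    obtain ⟨T₁, h₁, hT₁⟩ := bbB_fibre δ q _ Fa (Fa m) hδ.ne' hEa hFad
    obtain ⟨T₂, h₂, hT₂⟩ := bbB_fibre δ q _ Fb (Fa m) hδ.ne' hEb hFbd
    obtain ⟨T₃, h₃, hT₃⟩ := bbB_fibre δ q _ Fa (Fb m) hδ.ne' hEa hFad
    obtain ⟨T₄, h₄, hT₄⟩ := bbB_fibre δ q _ Fb (Fb m) hδ.ne' hEb hFbd
    refine ⟨T₁ ∪ T₂ ∪ T₃ ∪ T₄, ?_, ?_⟩
    · have c₁ := Finset.card_union_le (T₁ ∪ T₂ ∪ T₃) T₄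
      have c₂ := Finset.card_union_le (T₁ ∪ T₂) T₃
      have c₃ := Finset.card_union_le T₁ T₂
      omega
    · rintro m' ⟨-, h | h | h | h⟩ <;> simp only [Finset.mem_union]
      · exact Or.inl (Or.inl (Or.inl (hT₁ m' h.symm)))
      · exact Or.inl (Or.inl (Or.inr (hT₂ m' h.symm)))
      · exact Or.inl (Or.inr (hT₃ m' h.symm))
      · exact Or.inr (hT₄ m' h.symm)
  obtain ⟨S, hqS, hS⟩ := bbB_greedy q 400 _ hsymm hdeg
  obtain ⟨g, hgS, hgm⟩ : ∃ g : Fin S.card → Fin q, (∀ i, g i ∈ S) ∧ StrictMono g :=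
    ⟨S.orderEmbOfFin rfl, S.orderEmbOfFin_mem rfl, (S.orderEmbOfFin rfl).strictMono⟩
  have hgne : ∀ (m m' : ℕ) (hm : m < S.card) (hm' : m' < S.card), m ≠ m' → g ⟨m, hm⟩ ≠ g ⟨m', hm'⟩ :=
    fun m m' hm hm' hne h => hne (by simpa using hgm.injective h)
  -- (4) the thinned family, indexed by `ℕ`
  set a' : ℕ → ℕ := fun i => if h : i < S.card then a (g ⟨i, h⟩) else 0 with ha'
  set b' : ℕ → ℕ := fun i => if h : i < S.card then b (g ⟨i, h⟩) else 0 with hb'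
  set Fa' : ℕ → ℂ := fun i => if h : i < S.card then Fa (g ⟨i, h⟩) else 0 with hFa'
  set Fb' : ℕ → ℂ := fun i => if h : i < S.card then Fb (g ⟨i, h⟩) else 0 with hFb'
  have e1 : ∀ m (hm : m < S.card), a' m = a (g ⟨m, hm⟩) := fun m hm => by simp only [ha', dif_pos hm]
  have e2 : ∀ m (hm : m < S.card), b' m = b (g ⟨m, hm⟩) := fun m hm => by simp only [hb', dif_pos hm]
  have e3 : ∀ m (hm : m < S.card), Fa' m = Fa (g ⟨m, hm⟩) := fun m hm => by simp only [hFa', dif_pos hm]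
  have e4 : ∀ m (hm : m < S.card), Fb' m = Fb (g ⟨m, hm⟩) := fun m hm => by simp only [hFb', dif_pos hm]
  have hab' : ∀ m, m < S.card → a' m < b' m ∧ b' m < N := by
    intro m hm
    rw [e1 m hm, e2 m hm]
    exact hab _
  have hsep' : ∀ m m', m < m' → m' < S.card → b' m < a' m' := by
    intro m m' hmm' hm'
    rw [e2 m (hmm'.trans hm'), e1 m' hm']
    exact hsep (hgm (show (⟨m, hmm'.trans hm'⟩ : Fin S.card) < ⟨m', hm'⟩ from hmm'))
  have hside' : ∀ m, m < S.card →
      (dist (meshPoint δ (bsite (btour (↑B : Set (Site 2)) e (a' m)))) y ≤ σ₁ ∧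
          σ₂ ≤ dist (meshPoint δ (bsite (btour (↑B : Set (Site 2)) e (b' m)))) y) ∨
        (σ₂ ≤ dist (meshPoint δ (bsite (btour (↑B : Set (Site 2)) e (a' m)))) y ∧
          dist (meshPoint δ (bsite (btour (↑B : Set (Site 2)) e (b' m)))) y ≤ σ₁) := by
    intro m hm
    rw [e1 m hm, e2 m hm]
    exact hside _
  have hFa'' : ∀ m, m < S.card → Fa' m ∈ frontier D.carrier ∧
      Fa' m ∈ segment ℝ (meshPoint δ (bsite (btour (↑B : Set (Site 2)) e (a' m))))
        (meshPoint δ (bcontact (btour (↑B : Set (Site 2)) e (a' m)))) ∧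
      Fa' m ≠ meshPoint δ (bsite (btour (↑B : Set (Site 2)) e (a' m))) ∧
      (∀ z ∈ segment ℝ (meshPoint δ (bsite (btour (↑B : Set (Site 2)) e (a' m)))) (Fa' m), z ≠ Fa' m →
        z ∈ D.carrier) ∧
      dist (Fa' m) (meshPoint δ (bsite (btour (↑B : Set (Site 2)) e (a' m)))) ≤ δ := by
    intro m hm
    rw [e1 m hm, e3 m hm]
    obtain ⟨h1, h2, h3, h4, -⟩ := hFa (g ⟨m, hm⟩)
    exact ⟨h1, h2, h3, h4, (hFad _).trans_eq habs⟩
  have hFb'' : ∀ m, m < S.card → Fb' m ∈ frontier D.carrier ∧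
      Fb' m ∈ segment ℝ (meshPoint δ (bsite (btour (↑B : Set (Site 2)) e (b' m))))
        (meshPoint δ (bcontact (btour (↑B : Set (Site 2)) e (b' m)))) ∧
      Fb' m ≠ meshPoint δ (bsite (btour (↑B : Set (Site 2)) e (b' m))) ∧
      (∀ z ∈ segment ℝ (meshPoint δ (bsite (btour (↑B : Set (Site 2)) e (b' m)))) (Fb' m), z ≠ Fb' m →
        z ∈ D.carrier) ∧
      dist (Fb' m) (meshPoint δ (bsite (btour (↑B : Set (Site 2)) e (b' m)))) ≤ δ := by
    intro m hm
    rw [e2 m hm, e4 m hm]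
    obtain ⟨h1, h2, h3, h4, -⟩ := hFb (g ⟨m, hm⟩)
    exact ⟨h1, h2, h3, h4, (hFbd _).trans_eq habs⟩
  have hFai : ∀ m m', m < S.card → m' < S.card → Fa' m = Fa' m' → m = m' := by
    intro m m' hm hm' h
    rw [e3 m hm, e3 m' hm'] at h
    by_contra hne
    exact hS _ (hgS _) _ (hgS _) (hgne m m' hm hm' hne) ⟨hgne m m' hm hm' hne, Or.inl h⟩
  have hFbi : ∀ m m', m < S.card → m' < S.card → Fb' m = Fb' m' → m = m' := by
    intro m m' hm hm' h
    rw [e4 m hm, e4 m' hm'] at h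
    by_contra hne
    exact hS _ (hgS _) _ (hgS _) (hgne m m' hm hm' hne) ⟨hgne m m' hm hm' hne, Or.inr (Or.inr (Or.inr h))⟩
  have hFab : ∀ m m', m < S.card → m' < S.card → m ≠ m' → Fa' m ≠ Fb' m' := by
    intro m m' hm hm' hne h
    rw [e3 m hm, e4 m' hm'] at h
    exact hS _ (hgS _) _ (hgS _) (hgne m m' hm hm' hne) ⟨hgne m m' hm hm' hne, Or.inr (Or.inl h)⟩
  -- (5) the core and the count
  have hσδ : σ₁ + δ < σ₂ - δ := by linarith
  obtain ⟨k, hk, hT⟩ := bbB_core D δ B e N H Γ y σ₁ σ₂ S.card a' b' Fa' Fb' hδ hσδ hBD hBG hBconn he hN hper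
    hinj hball hsphere hclosed hΓ hab' hsep' hside' hFa'' hFb'' hFai hFbi hFab
  have hT' : Γ.HasTraversals k y (σ₁ + w) (σ₂ - w) := hT.mono' (by linarith) (by linarith)
  have hkk : k < k₀ := by
    by_contra h
    exact hk₀ (hT'.of_le (not_lt.1 h))
  calc q ≤ (400 + 1) * S.card := hqS
    _ ≤ 401 * (k + 2) := by omega
    _ ≤ 401 * (k₀ + 1) := by omega

end Summit.CriticalPhenomena.SAWScalingLimit.Theorems.FKGToTraversalBound.SlitNecklace

end
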